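import Summits.ValiantsHypothesis.ValiantsHypothesis.Theorems.KPlusLogSqLawTropicalBSplitGlue

/-!
# Route `KPlusLogSqLaw`, crux `TropicalB` (stmt-ValiantsHypothesis-19771) — ONE CUT IS UNIVERSAL (strip normal form), part 1: the gadget
#
# the unsigned tropical row of every format `(m, K)` follows from the row of the designs of format `((m+1)·m, K+1)`
# whose slope-carrying entries all lie in the first `m` columns

HONEST FRAMING.  Helper file (seat val-sym-trop-p1 g16, cell `pub-symmetroid`, 2026-08-28) toward the registered stubs
`stub_tropThin` / `stub_tropFat` of `Cruxes/TropicalB/Lines/birth.lean` (crux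
`Summit.ValiantsHypothesis.ValiantsHypothesis.Theses.KPlusLogSqLaw.TropicalB`, item `stmt-ValiantsHypothesis-19771`, route
`KPlusLogSqLaw`; `--supports … --as helper`).  A NORMAL-FORM reduction of the crux (same genre as `…TropicalBColumnFanout`,
`…TropicalBThresholdIff`, `…TropicalBStaticDiagonal`); it bounds nothing for `TropicalB` and bears on neither `WeakLifting`, the doors,
`MatrixDescartes` (stmt-ValiantsHypothesis-18050) nor VP ≠ VNP.

THE REDUCTION (one cut / slope strip).  Call a design of format `(M, K')` a STRIP design of width `w` when every present entry in a
column of index `≥ w` carries a class of exponent `0` — only the first `w` columns carry slope.  For a strip design the slope of a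
term is read off the row set `σ({columns < w})` together with the classes chosen there: the chain length is a VISITED-STATE count at ONE
column cut (compare `…TropicalBVisitedStates`, `…TropicalBHalves`).  Given an arbitrary design `(d, v, ε)` of format `(m, K)`, index a big
design by `Fin (m+1) × Fin m` (transported to `Fin ((m+1)·m)` by `finProdFinEquiv`, so that `(0, c) ↦ c` and `(t, a) ↦ a + m·t`):
the row `(0, a)` is the SPARE row of the original row `a`, the row `(b+1, a)` is the CELL `(a, b)` of the original matrix; the column
`(0, c)` is the original column `c` (the strip, indices `< m`), the column `(b+1, a)` is the PARKING slot of the cell `(a, b)`.  Present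
entries (row ← column): the strip column `(0, c)` accepts exactly the cells `(a, c)` of the original column `c`, with every class of the
original entry `(a, c)` (classes shifted by `Fin.castSucc`, original valuation and sign); the parking slot of the cell `(a, b)` accepts
that cell or the spare row `(0, a)`, with the new zero-exponent class `Fin.last K`, valuation `0`, sign `1`.  A term `(σ, λ)` of the
original design becomes: strip column `c` ← cell `(σ c, c)` with class `λ c`; the parking slot of `(a, b)` ← the spare row `(0, a)` if
`σ b = a`, else its own cell.  Conversely every present term of the big design is of this form (`descent`: the spare row of `a` parks in
exactly one slot `(a, b_a)`, so the cell `(a, b_a)` sits in the strip column `b_a` and all other cells of row `a` are parked; the strip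
columns hold one cell each, so `a ↦ b_a` is a bijection), with the same tropical weight at every slope.  Hence unique optima correspond,
and

  `tropRowD_of_strip : (∀ strip designs (d', v', ε') of width m and format ((m+1)·m, K+1), DesignRowD d' v' ε' B) → TropRowD m K B`,
  `tropicalB_iff_strip : TropicalB ↔ ∃ C, ∀ m K, every such strip design has unsigned dominant chains of length ≤ 2^(C·(K+1+⌊log₂ m⌋²))`
(both in part 2, `…TropicalBOneCut`).  THIS FILE: the entry table of the gadget (`cases_of_E`, `E_cell`, `V_cell`, `E_slot`, `V_slot`),
injectivity of the big column-to-row map (`liftFun_injective`) and the size arithmetic `log₂((m+1)m) ≤ 2 log₂ m + 1`.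

READING (located, not claimed).  The `K + log² m` law is equivalent to its restriction to designs in which the exponent matrix is
supported on a strip of `√M` columns — equivalently (deleting the zero class) the parametric objective is `θ·w(A) − V`, `A` the set of
rows matched into the strip: «rank-one» parametric assignment / a visited-state bound at a single balanced-by-weight cut.  Unsigned
currency (`DesignRowD`/`TropRowD` of `…TropicalBSplitDefs`; `tropicalB_iff_unsigned`, p444755, moves between currencies).  [folklore] (gadget)
-/

set_option linter.dupNamespace false
set_option autoImplicit false

namespace Summit.ValiantsHypothesis.ValiantsHypothesis.Theorems.KPlusLogSqLaw

open Summit.ValiantsHypothesis.ValiantsHypothesis.Theorems.MatrixDescartes.Negative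
open Summit.ValiantsHypothesis.ValiantsHypothesis.Theorems.LacunarySymmetroidMatrixDescartes
open scoped BigOperators
open Finset

namespace OneCut

variable {m K : ℕ}

/-! ## 1. The structured big design and its entries -/

/-- The present-entry table of the big design, read off its defining formula: a present entry is either a CELL in its STRIP column
(with an original class) or a cell / spare row in a PARKING slot (with the new last class). [folklore] -/
theorem cases_of_E (ε : Fin m → Fin m → Fin K → ℤ) (E : Fin (m + 1) × Fin m → Fin (m + 1) × Fin m → Fin (K + 1) → ℤ)
    (hE : ∀ r c l, E r c l =
      (if (c.1 : ℕ) = 0 then (if (r.1 : ℕ) = (c.2 : ℕ) + 1 then (if h : (l : ℕ) < K then ε r.2 c.2 ⟨l, h⟩ else 0) else 0)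
       else if r.2 = c.2 ∧ ((r.1 : ℕ) = 0 ∨ r.1 = c.1) ∧ l = Fin.last K then 1 else 0))
    (r c : Fin (m + 1) × Fin m) (l : Fin (K + 1)) (h : E r c l ≠ 0) :
    ((c.1 : ℕ) = 0 ∧ (r.1 : ℕ) = (c.2 : ℕ) + 1 ∧ ∃ hl : (l : ℕ) < K, ε r.2 c.2 ⟨l, hl⟩ ≠ 0) ∨
    ((c.1 : ℕ) ≠ 0 ∧ r.2 = c.2 ∧ ((r.1 : ℕ) = 0 ∨ r.1 = c.1) ∧ l = Fin.last K) := by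
  rw [hE] at h
  by_cases h0 : (c.1 : ℕ) = 0
  · rw [if_pos h0] at h
    by_cases h1 : (r.1 : ℕ) = (c.2 : ℕ) + 1
    · rw [if_pos h1] at h
      by_cases hl : (l : ℕ) < K
      · rw [dif_pos hl] at h
        exact Or.inl ⟨h0, h1, hl, h⟩
      · rw [dif_neg hl] at h; exact absurd rfl h
    · rw [if_neg h1] at h; exact absurd rfl h
  · rw [if_neg h0] at h
    by_cases h2 : r.2 = c.2 ∧ ((r.1 : ℕ) = 0 ∨ r.1 = c.1) ∧ l = Fin.last K
    · exact Or.inr ⟨h0, h2⟩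
    · rw [if_neg h2] at h; exact absurd rfl h

/-! ## 2. The big permutation of an original permutation -/

/-- The column-to-row map of the big term of `σ`: strip column `c` ← cell `(σ c, c)`; parking slot of the cell `(a, b)` ← the spare row
of `a` if `σ b = a`, else the cell itself.  It is injective (hence a permutation of the finite index type). [folklore] -/
theorem liftFun_injective (σ : Equiv.Perm (Fin m)) (F : Fin (m + 1) × Fin m → Fin (m + 1) × Fin m)
    (hF : ∀ u, F u = if h : u.1 = 0 then (Fin.succ u.2, σ u.2)
      else (if σ (u.1.pred h) = u.2 then ((0 : Fin (m + 1)), u.2) else u)) :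
    Function.Injective F := by
  intro u u' huu
  rw [hF u, hF u'] at huu
  by_cases h : u.1 = 0 <;> by_cases h' : u'.1 = 0
  · rw [dif_pos h, dif_pos h'] at huu
    have h2 : u.2 = u'.2 := Fin.succ_inj.mp (congrArg Prod.fst huu)
    exact Prod.ext (h.trans h'.symm) h2
  · rw [dif_pos h, dif_neg h'] at huu
    exfalso
    by_cases hs : σ (u'.1.pred h') = u'.2
    · rw [if_pos hs] at huu
      exact Fin.succ_ne_zero _ (congrArg Prod.fst huu)
    · rw [if_neg hs] at huu
      apply hs
      have h1 : Fin.succ u.2 = u'.1 := congrArg Prod.fst huu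
      have h2 : σ u.2 = u'.2 := congrArg Prod.snd huu
      have : u'.1.pred h' = u.2 := by
        rw [← Fin.succ_inj, Fin.succ_pred]; exact h1.symm
      rw [this, h2]
  · rw [dif_neg h, dif_pos h'] at huu
    exfalso
    by_cases hs : σ (u.1.pred h) = u.2
    · rw [if_pos hs] at huu
      exact Fin.succ_ne_zero _ (congrArg Prod.fst huu).symm
    · rw [if_neg hs] at huu
      apply hs
      have h1 : u.1 = Fin.succ u'.2 := congrArg Prod.fst huu
      have h2 : u.2 = σ u'.2 := congrArg Prod.snd huu
      have : u.1.pred h = u'.2 := by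
        rw [← Fin.succ_inj, Fin.succ_pred]; exact h1
      rw [this, h2]
  · rw [dif_neg h, dif_neg h'] at huu
    by_cases hs : σ (u.1.pred h) = u.2 <;> by_cases hs' : σ (u'.1.pred h') = u'.2
    · rw [if_pos hs, if_pos hs'] at huu
      have h2 : u.2 = u'.2 := (Prod.mk.injEq _ _ _ _ ▸ huu).2
      have h1 : u.1.pred h = u'.1.pred h' := σ.injective (by rw [hs, hs', h2])
      exact Prod.ext (Fin.pred_inj.mp h1) h2
    · rw [if_pos hs, if_neg hs'] at huu
      exfalso; exact h' (congrArg Prod.fst huu).symm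
    · rw [if_neg hs, if_pos hs'] at huu
      exfalso; exact h (congrArg Prod.fst huu)
    · rw [if_neg hs, if_neg hs'] at huu
      exact huu

/-- entry of a CELL in its strip column, at an original class. [folklore] -/
theorem E_cell (ε : Fin m → Fin m → Fin K → ℤ) (E : Fin (m + 1) × Fin m → Fin (m + 1) × Fin m → Fin (K + 1) → ℤ)
    (hE : ∀ r c l, E r c l =
      (if (c.1 : ℕ) = 0 then (if (r.1 : ℕ) = (c.2 : ℕ) + 1 then (if h : (l : ℕ) < K then ε r.2 c.2 ⟨l, h⟩ else 0) else 0)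
       else if r.2 = c.2 ∧ ((r.1 : ℕ) = 0 ∨ r.1 = c.1) ∧ l = Fin.last K then 1 else 0))
    (a c : Fin m) (l : Fin K) : E (Fin.succ c, a) ((0 : Fin (m + 1)), c) (Fin.castSucc l) = ε a c l := by
  rw [hE]
  have h1 : (((0 : Fin (m + 1)), c).1 : ℕ) = 0 := rfl
  have h2 : (((Fin.succ c, a) : Fin (m + 1) × Fin m).1 : ℕ) = ((((0 : Fin (m + 1)), c).2 : Fin m) : ℕ) + 1 := Fin.val_succ c
  have h3 : ((Fin.castSucc l : Fin (K + 1)) : ℕ) < K := by simp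
  rw [if_pos h1, if_pos h2, dif_pos h3]
  rfl

/-- valuation of a CELL in its strip column, at an original class. [folklore] -/
theorem V_cell (v : Fin m → Fin m → Fin K → ℤ) (V : Fin (m + 1) × Fin m → Fin (m + 1) × Fin m → Fin (K + 1) → ℤ)
    (hV : ∀ r c l, V r c l =
      (if h : (c.1 : ℕ) = 0 ∧ (r.1 : ℕ) = (c.2 : ℕ) + 1 ∧ (l : ℕ) < K then v r.2 c.2 ⟨l, h.2.2⟩ else 0))
    (a c : Fin m) (l : Fin K) : V (Fin.succ c, a) ((0 : Fin (m + 1)), c) (Fin.castSucc l) = v a c l := by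
  rw [hV]
  have h1 : (((0 : Fin (m + 1)), c).1 : ℕ) = 0 := rfl
  have h2 : (((Fin.succ c, a) : Fin (m + 1) × Fin m).1 : ℕ) = ((((0 : Fin (m + 1)), c).2 : Fin m) : ℕ) + 1 := Fin.val_succ c
  have h3 : ((Fin.castSucc l : Fin (K + 1)) : ℕ) < K := by simp
  rw [dif_pos ⟨h1, h2, h3⟩]
  rfl

/-- entry of a PARKING slot: the spare row or the cell itself, at the last class. [folklore] -/
theorem E_slot (ε : Fin m → Fin m → Fin K → ℤ) (E : Fin (m + 1) × Fin m → Fin (m + 1) × Fin m → Fin (K + 1) → ℤ)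
    (hE : ∀ r c l, E r c l =
      (if (c.1 : ℕ) = 0 then (if (r.1 : ℕ) = (c.2 : ℕ) + 1 then (if h : (l : ℕ) < K then ε r.2 c.2 ⟨l, h⟩ else 0) else 0)
       else if r.2 = c.2 ∧ ((r.1 : ℕ) = 0 ∨ r.1 = c.1) ∧ l = Fin.last K then 1 else 0))
    (r u : Fin (m + 1) × Fin m) (hu : (u.1 : ℕ) ≠ 0) (hr : r = ((0 : Fin (m + 1)), u.2) ∨ r = u) :
    E r u (Fin.last K) = 1 := by
  rw [hE, if_neg hu, if_pos]
  rcases hr with hr | hr <;> rw [hr]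
  · exact ⟨rfl, Or.inl rfl, rfl⟩
  · exact ⟨rfl, Or.inr rfl, rfl⟩

/-- valuation of a PARKING slot. [folklore] -/
theorem V_slot (v : Fin m → Fin m → Fin K → ℤ) (V : Fin (m + 1) × Fin m → Fin (m + 1) × Fin m → Fin (K + 1) → ℤ)
    (hV : ∀ r c l, V r c l =
      (if h : (c.1 : ℕ) = 0 ∧ (r.1 : ℕ) = (c.2 : ℕ) + 1 ∧ (l : ℕ) < K then v r.2 c.2 ⟨l, h.2.2⟩ else 0))
    (r u : Fin (m + 1) × Fin m) (hu : (u.1 : ℕ) ≠ 0) (l : Fin (K + 1)) : V r u l = 0 := by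
  rw [hV, dif_neg]
  intro hh; exact hu hh.1

/-! ## 3. Size arithmetic -/

/-- `log₂ ((m+1)·m) ≤ 2·log₂ m + 1`. [folklore] -/
theorem log_succ_mul_self_le (m : ℕ) : Nat.log 2 ((m + 1) * m) ≤ 2 * Nat.log 2 m + 1 := by
  rcases Nat.eq_zero_or_pos m with rfl | hm
  · simp
  · set L := Nat.log 2 m with hL
    have h1 : m < 2 ^ (L + 1) := Nat.lt_pow_succ_log_self (by norm_num) m
    have h2 : (m + 1) * m < 2 ^ (2 * L + 2) := by
      have h3 : m + 1 ≤ 2 ^ (L + 1) := h1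
      calc (m + 1) * m < (m + 1) * 2 ^ (L + 1) := Nat.mul_lt_mul_of_pos_left h1 (Nat.succ_pos m)
        _ ≤ 2 ^ (L + 1) * 2 ^ (L + 1) := Nat.mul_le_mul_right _ h3
        _ = 2 ^ (2 * L + 2) := by rw [← pow_add]; ring_nf
    have h4 : Nat.log 2 ((m + 1) * m) < 2 * L + 2 :=
      Nat.log_lt_of_lt_pow' (by omega) h2
    omega

end OneCut

end Summit.ValiantsHypothesis.ValiantsHypothesis.Theorems.KPlusLogSqLaw
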